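import Mathlib
import HarnessLib
import Literature.MathematicalPhysics.QuantumFieldTheory.LatticeGaugeProofs
import Summits.Ventures.LatticeQCDFlow.Scoring.HMCKernelTranslation
import Summits.Ventures.LatticeQCDFlow.Scoring.WilsonFlowRK3Reflection
import Summits.Ventures.LatticeQCDFlow.Scoring.WilsonFlowRK3Consistency
import Summits.Ventures.LatticeQCDFlow.Exactness.DoeblinAutocovariance
import Summits.Ventures.LatticeQCDFlow.Scoring.FlowedEnergyLatticeSymmetry

/-!
# Under a translation-invariant law the second moment of a lattice sum is the volume times the summed two-point function from the origin: `E[(Σ_x f_x)²] = |Λ| Σ_v E[f_0 f_v]` — at every HMC step, for the measured charge (`E[Q²] = |Λ| Σ_v E[q_0 q_v]`) and for plaquette fields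

HONEST FRAMING: exact (Metropolis-corrected) sampling algorithms for lattice gauge theory;
figures of merit are autocorrelation/cost numbers at stated couplings and volumes; no
continuum-physics claim.

Venture `LatticeQCDFlow` (cell pub-lqcd), sub-topic `Scoring`, FANOUT row 21 (`su3-base`: acceptance (c) compares `⟨Q²⟩` —
the topological susceptibility times the volume — and the run check uses the lattice-AVERAGED plaquette; row 21's
`HMCPlaquetteHomogeneity` proved the averaged one-point function equals the single-site one and wrote "NOT CLAIMED: anything
about the variance of the average (that is where the volume helps)").  THIS file is that second-moment statement, as an exact
finite-volume identity.  NEW WORK of the cell; def-free; nothing is cited as a fact; no number.  Tools: the Literature's torus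
translation `TorusTranslation.torusConfigShift` (`LatticeGaugeProofs`: `plaquetteHolonomy_torusConfigShift`,
`wilsonMeasure_map_torusConfigShift`), row 21's `HMCKernelTranslation` (`hmcChain_law_map_torusConfigShift`: the `N`-step law
of arm E2 from a translation-invariant start is translation invariant), row 16's `WilsonFlowRK3Reflection` /
`CloverDensityMeanZero` (`iterate_wilsonFlowRK3_torusConfigShift`, `cloverPseudoscalar_torusConfigShift`).

## What is here (torus `(ℤ/L)^d`, any measurable group `G`, a law `μ` on configurations with `μ ∘ τ_v⁻¹ = μ` for all `v`)

A SITE FIELD is `f : Site → Config → ℝ` with `f_x(τ_v U) = f_{x−v}(U)` (translation covariance; plaquette functions, the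
flowed charge density, the flowed energy density are such).
* §1 `integral_siteField_eq_origin` (`E[f_x] = E[f_0]`), `integral_siteField_mul_translate`
  (`E[f_x g_y] = E[f_0 g_{y−x}]`), **`integral_sum_mul_sum_siteField`** (`E[(Σ_x f_x)(Σ_y g_y)] = |Λ| Σ_v E[f_0 g_v]`),
  **`integral_sq_sum_siteField`** (`E[(Σ_x f_x)²] = |Λ| Σ_v E[f_0 f_v]`), `integral_sum_siteField` (`E[Σ f_x] = |Λ| E[f_0]`),
  and the variance form **`variance_average_siteField`**: `E[A²] − E[A]² = |Λ|⁻¹ Σ_v (E[f_0 f_v] − E[f_0] E[f_v])` for the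
  volume average `A = |Λ|⁻¹ Σ_x f_x` — the average's variance is the summed connected two-point function over the volume,
  NOT `Var(f_0)/|Λ|` unless the sites are uncorrelated.
* §2 the laws: the Wilson measure (`wilsonMeasure_map_torusConfigShift`) and arm E2's `N`-step law from the cold or hot start.
* §3 the fields: plaquette functions `φ(U_{x;ij})`; the measured charge density `q_x = P_x ∘ RK3^m`; the measured energy
  density `E_x ∘ RK3^m` (row 21's `FlowedEnergyLatticeSymmetry.rk3CloverEnergy_torusConfigShift`); hence
  **`integral_sq_rk3CloverCharge_hmcChain`**: at EVERY HMC step `N`, `E_N[Q²] = |Λ| Σ_v E_N[q_0 q_v]` (cold / hot start), and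
  **`wilsonExpectation_sq_rk3CloverCharge`**: the same in equilibrium — the estimator of acceptance (c) is `|Λ|` times the summed
  charge-density two-point function, exactly, configuration law by configuration law; and the `t²E` twins
  **`integral_sq_rk3CloverEnergy_hmcColdStart/HotStart/wilsonMeasure`** (`E[(Σ_x E_x)²] = |Λ| Σ_v E[E_0 E_v]`) together with
  the VARIANCE of the lattice-averaged energy `variance_rk3CloverEnergyAverage_hmcColdStart` (`= |Λ|⁻¹ Σ_v Cov(E_0, E_v)`).
NOT CLAIMED: any bound on the two-point function (clustering), any statement about `τ_int`, arm E1, numbers.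
-/

noncomputable section

open MeasureTheory ProbabilityTheory
open Literature.MathematicalPhysics.QuantumFieldTheory
open Literature.MathematicalPhysics.QuantumFieldTheory.Luscher2010 (SuBasis)
open Literature.MathematicalPhysics.QuantumLattice (fundamentalRep continuous_fundamentalRep cloverPseudoscalar
  continuous_cloverPseudoscalar flowedCloverEnergy continuous_flowedCloverEnergy_zero)
open Summit.Ventures.LatticeQCDFlow.Exactness (nHit isMarkovKernel_nHit)

namespace Summit.Ventures.LatticeQCDFlow.Scoring

/-! ## §1 Site fields under a translation-invariant law -/

section Generic

variable {d L : ℕ} {G : Type*} [MeasurableSpace G]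
variable {μ : Measure (GaugeConfig d L G)} (hμ : ∀ v : Site d L, μ.map (TorusTranslation.torusConfigShift v) = μ)

include hμ

/-- Translation invariance as an integral identity: `∫ F(τ_v U) dμ = ∫ F dμ`. -/
theorem integral_comp_torusConfigShift_of_invariant {E : Type*} [NormedAddCommGroup E] [NormedSpace ℝ E]
    (v : Site d L) (F : GaugeConfig d L G → E) :
    ∫ U, F (TorusTranslation.torusConfigShift v U) ∂μ = ∫ U, F U ∂μ :=
  (MeasurePreserving.mk (TorusTranslation.torusConfigShift v).measurable (hμ v)).integral_comp' F

/-- **`E[f_x] = E[f_0]`** for a translation-covariant site field. -/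
theorem integral_siteField_eq_origin (f : Site d L → GaugeConfig d L G → ℝ)
    (hf : ∀ v x U, f x (TorusTranslation.torusConfigShift v U) = f (x - v) U) (x : Site d L) :
    ∫ U, f x U ∂μ = ∫ U, f 0 U ∂μ := by
  have h := integral_comp_torusConfigShift_of_invariant hμ x (f x)
  simp only [hf, sub_self] at h
  exact h.symm

/-- **`E[f_x · g_y] = E[f_0 · g_{y−x}]`**: mixed second moments depend on the separation only. -/
theorem integral_siteField_mul_translate (f g : Site d L → GaugeConfig d L G → ℝ)
    (hf : ∀ v x U, f x (TorusTranslation.torusConfigShift v U) = f (x - v) U)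
    (hg : ∀ v x U, g x (TorusTranslation.torusConfigShift v U) = g (x - v) U) (x y : Site d L) :
    ∫ U, f x U * g y U ∂μ = ∫ U, f 0 U * g (y - x) U ∂μ := by
  have h := integral_comp_torusConfigShift_of_invariant hμ x (fun U => f x U * g y U)
  simp only [hf, hg, sub_self] at h
  exact h.symm

variable [NeZero L]

/-- **`E[(Σ_x f_x)(Σ_y g_y)] = |Λ| · Σ_v E[f_0 g_v]`** (all products integrable). -/
theorem integral_sum_mul_sum_siteField (f g : Site d L → GaugeConfig d L G → ℝ)
    (hf : ∀ v x U, f x (TorusTranslation.torusConfigShift v U) = f (x - v) U)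
    (hg : ∀ v x U, g x (TorusTranslation.torusConfigShift v U) = g (x - v) U)
    (hint : ∀ x y, Integrable (fun U => f x U * g y U) μ) :
    ∫ U, (∑ x, f x U) * (∑ y, g y U) ∂μ =
      (Fintype.card (Site d L) : ℝ) * ∑ v, ∫ U, f 0 U * g v U ∂μ := by
  have hexp : ∀ U : GaugeConfig d L G, (∑ x, f x U) * (∑ y, g y U) = ∑ x, ∑ y, f x U * g y U := fun U => by
    rw [Finset.sum_mul_sum]
  simp only [hexp]
  rw [integral_finsetSum _ fun x _ => integrable_finsetSum _ fun y _ => hint x y]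
  have hin : ∀ x : Site d L, ∫ U, ∑ y, f x U * g y U ∂μ = ∑ v, ∫ U, f 0 U * g v U ∂μ := by
    intro x
    rw [integral_finsetSum _ fun y _ => hint x y]
    simp only [integral_siteField_mul_translate hμ f g hf hg x]
    exact Fintype.sum_equiv (Equiv.subRight x) _ _ fun y => rfl
  simp only [hin, Finset.sum_const, Finset.card_univ, nsmul_eq_mul]

/-- **`E[(Σ_x f_x)²] = |Λ| · Σ_v E[f_0 f_v]`.** -/
theorem integral_sq_sum_siteField (f : Site d L → GaugeConfig d L G → ℝ)
    (hf : ∀ v x U, f x (TorusTranslation.torusConfigShift v U) = f (x - v) U)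
    (hint : ∀ x y, Integrable (fun U => f x U * f y U) μ) :
    ∫ U, (∑ x, f x U) ^ 2 ∂μ = (Fintype.card (Site d L) : ℝ) * ∑ v, ∫ U, f 0 U * f v U ∂μ := by
  simp only [sq]
  exact integral_sum_mul_sum_siteField hμ f f hf hf hint

/-- `E[Σ_x f_x] = |Λ| · E[f_0]`. -/
theorem integral_sum_siteField (f : Site d L → GaugeConfig d L G → ℝ)
    (hf : ∀ v x U, f x (TorusTranslation.torusConfigShift v U) = f (x - v) U) (hint : ∀ x, Integrable (f x) μ) :
    ∫ U, ∑ x, f x U ∂μ = (Fintype.card (Site d L) : ℝ) * ∫ U, f 0 U ∂μ := by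
  rw [integral_finsetSum _ fun x _ => hint x]
  simp only [integral_siteField_eq_origin hμ f hf, Finset.sum_const, Finset.card_univ, nsmul_eq_mul]

/-- **THE VARIANCE OF THE VOLUME AVERAGE IS THE SUMMED CONNECTED TWO-POINT FUNCTION OVER THE VOLUME**:
for `A = |Λ|⁻¹ Σ_x f_x`, `E[A²] − E[A]² = |Λ|⁻¹ Σ_v (E[f_0 f_v] − E[f_0] E[f_v])`. -/
theorem variance_average_siteField (f : Site d L → GaugeConfig d L G → ℝ)
    (hf : ∀ v x U, f x (TorusTranslation.torusConfigShift v U) = f (x - v) U) (hint : ∀ x, Integrable (f x) μ)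
    (hint2 : ∀ x y, Integrable (fun U => f x U * f y U) μ) :
    ∫ U, ((Fintype.card (Site d L) : ℝ)⁻¹ * ∑ x, f x U) ^ 2 ∂μ - (∫ U, (Fintype.card (Site d L) : ℝ)⁻¹ * ∑ x, f x U ∂μ) ^ 2 =
      (Fintype.card (Site d L) : ℝ)⁻¹ * ∑ v, (∫ U, f 0 U * f v U ∂μ - (∫ U, f 0 U ∂μ) * ∫ U, f v U ∂μ) := by
  have hV : (Fintype.card (Site d L) : ℝ) ≠ 0 := Nat.cast_ne_zero.2 Fintype.card_ne_zero
  simp only [mul_pow, integral_const_mul]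
  rw [integral_sq_sum_siteField hμ f hf hint2, integral_sum_siteField hμ f hf hint]
  simp only [integral_siteField_eq_origin hμ f hf, Finset.sum_sub_distrib, Finset.sum_const, Finset.card_univ, nsmul_eq_mul]
  field_simp

end Generic

/-! ## §2 The fields: plaquette functions and the measured charge density are translation covariant -/

section Fields

variable {d L n : ℕ}

/-- A function of one plaquette holonomy is a translation-covariant site field (each orientation `(i, j)`). -/
theorem plaquetteField_torusConfigShift {G : Type*} [Group G] [MeasurableSpace G] {E : Type*} (φ : G → E) (i j : Fin d)
    (v x : Site d L) (U : GaugeConfig d L G) :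
    φ (plaquetteHolonomy (TorusTranslation.torusConfigShift v U) x i j) = φ (plaquetteHolonomy U (x - v) i j) := by
  rw [plaquetteHolonomy_torusConfigShift]

/-- The measured charge density `q_x = P_x ∘ RK3_{ε'}^m` is a translation-covariant site field. -/
theorem rk3CloverDensity_torusConfigShift (ε' : ℝ) (m : ℕ) (v x : Site 4 L)
    (U : GaugeConfig 4 L (Matrix.specialUnitaryGroup (Fin n) ℂ)) :
    cloverPseudoscalar (fundamentalRep (Fin n)) x ((wilsonFlowRK3 ε')^[m] (TorusTranslation.torusConfigShift v U)) =
      cloverPseudoscalar (fundamentalRep (Fin n)) (x - v) ((wilsonFlowRK3 ε')^[m] U) := by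
  rw [iterate_wilsonFlowRK3_torusConfigShift, cloverPseudoscalar_torusConfigShift]

/-- A continuous real observable of `SU(n)` configurations is integrable for every finite law (compactness). -/
theorem integrable_of_continuous_sunConfig [NeZero L] {μ : Measure (GaugeConfig d L (Matrix.specialUnitaryGroup (Fin n) ℂ))}
    [IsFiniteMeasure μ] {F : GaugeConfig d L (Matrix.specialUnitaryGroup (Fin n) ℂ) → ℝ} (hF : Continuous F) :
    Integrable F μ := by
  obtain ⟨C, hC⟩ := (isCompact_univ.image (continuous_abs.comp hF)).isBounded.bddAbove
  exact Integrable.mono' (integrable_const C) hF.measurable.aestronglyMeasurable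
    (ae_of_all _ fun U => by rw [Real.norm_eq_abs]; exact hC ⟨U, Set.mem_univ _, rfl⟩)

/-- The product of two measured charge densities is continuous, hence integrable for every finite law. -/
theorem continuous_rk3CloverDensity_mul [NeZero L] (ε' : ℝ) (m : ℕ) (x y : Site 4 L) :
    Continuous fun U : GaugeConfig 4 L (Matrix.specialUnitaryGroup (Fin n) ℂ) =>
      cloverPseudoscalar (fundamentalRep (Fin n)) x ((wilsonFlowRK3 ε')^[m] U) *
        cloverPseudoscalar (fundamentalRep (Fin n)) y ((wilsonFlowRK3 ε')^[m] U) :=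
  ((continuous_cloverPseudoscalar _ (continuous_fundamentalRep (Fin n)) x).comp (continuous_iterate_wilsonFlowRK3 ε' m)).mul
    ((continuous_cloverPseudoscalar _ (continuous_fundamentalRep (Fin n)) y).comp (continuous_iterate_wilsonFlowRK3 ε' m))

/-- The measured energy density `E_x ∘ RK3^m` is continuous. -/
theorem continuous_rk3CloverEnergy [NeZero L] (ε' : ℝ) (m : ℕ) (x : Site 4 L) :
    Continuous fun U : GaugeConfig 4 L (Matrix.specialUnitaryGroup (Fin n) ℂ) =>
      flowedCloverEnergy (fundamentalRep (Fin n)) 0 x ((wilsonFlowRK3 ε')^[m] U) :=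
  (continuous_flowedCloverEnergy_zero _ (continuous_fundamentalRep (Fin n)) x).comp (continuous_iterate_wilsonFlowRK3 ε' m)

end Fields

/-! ## §3 Arm E2 at every step, and equilibrium: `E[Q²] = |Λ| Σ_v E[q_0 q_v]` -/

section ArmE2

variable {L n : ℕ} [NeZero L] (B : SuBasis n) (β ε : ℝ) (w : List MDOp)

/-- **`E_N[Q²] = |Λ| · Σ_v E_N[q_0 q_v]` AT EVERY HMC STEP** from any translation-invariant start, for the measured charge
`Q = Σ_x q_x`, `q_x = P_x ∘ RK3_{ε'}^m` (products integrable for the `N`-step law — automatic from a probability start, see the cold / hot corollaries). -/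
theorem integral_sq_rk3CloverCharge_hmcChain {μ₀ : Measure (GaugeConfig 4 L (Matrix.specialUnitaryGroup (Fin n) ℂ))}
    (hT : ∀ v : Site 4 L, μ₀.map (TorusTranslation.torusConfigShift v) = μ₀) (N : ℕ) (ε' : ℝ) (m : ℕ)
    (hint : ∀ x y : Site 4 L, Integrable (fun U : GaugeConfig 4 L (Matrix.specialUnitaryGroup (Fin n) ℂ) =>
      cloverPseudoscalar (fundamentalRep (Fin n)) x ((wilsonFlowRK3 ε')^[m] U) *
        cloverPseudoscalar (fundamentalRep (Fin n)) y ((wilsonFlowRK3 ε')^[m] U)) (μ₀.bind (nHit (hmcKernel B β ε w) N))) :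
    ∫ U, (∑ x : Site 4 L, cloverPseudoscalar (fundamentalRep (Fin n)) x ((wilsonFlowRK3 ε')^[m] U)) ^ 2
        ∂(μ₀.bind (nHit (hmcKernel B β ε w) N)) =
      (Fintype.card (Site 4 L) : ℝ) * ∑ v : Site 4 L,
        ∫ U, cloverPseudoscalar (fundamentalRep (Fin n)) 0 ((wilsonFlowRK3 ε')^[m] U) *
          cloverPseudoscalar (fundamentalRep (Fin n)) v ((wilsonFlowRK3 ε')^[m] U) ∂(μ₀.bind (nHit (hmcKernel B β ε w) N)) :=
  integral_sq_sum_siteField (hmcChain_law_map_torusConfigShift B β ε w · (hT _) N)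
    (fun x U => cloverPseudoscalar (fundamentalRep (Fin n)) x ((wilsonFlowRK3 ε')^[m] U))
    (fun v x U => rk3CloverDensity_torusConfigShift ε' m v x U) hint

/-- **`E[(Σ_p φ(U_p))²] = |Λ| Σ_v E[φ(U_{0;ij}) φ(U_{v;ij})]` at every HMC step** for a plaquette function of one orientation. -/
theorem integral_sq_plaquetteSum_hmcChain {d : ℕ} {μ₀ : Measure (GaugeConfig d L (Matrix.specialUnitaryGroup (Fin n) ℂ))}
    (hT : ∀ v : Site d L, μ₀.map (TorusTranslation.torusConfigShift v) = μ₀) (N : ℕ)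
    (φ : Matrix.specialUnitaryGroup (Fin n) ℂ → ℝ) (i j : Fin d)
    (hint : ∀ x y : Site d L, Integrable (fun U : GaugeConfig d L (Matrix.specialUnitaryGroup (Fin n) ℂ) =>
      φ (plaquetteHolonomy U x i j) * φ (plaquetteHolonomy U y i j)) (μ₀.bind (nHit (hmcKernel B β ε w) N))) :
    ∫ U, (∑ x : Site d L, φ (plaquetteHolonomy U x i j)) ^ 2 ∂(μ₀.bind (nHit (hmcKernel B β ε w) N)) =
      (Fintype.card (Site d L) : ℝ) * ∑ v : Site d L,
        ∫ U, φ (plaquetteHolonomy U 0 i j) * φ (plaquetteHolonomy U v i j) ∂(μ₀.bind (nHit (hmcKernel B β ε w) N)) :=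
  integral_sq_sum_siteField (hmcChain_law_map_torusConfigShift B β ε w · (hT _) N)
    (fun x U => φ (plaquetteHolonomy U x i j)) (fun v x U => plaquetteField_torusConfigShift φ i j v x U) hint

/-- Cold start (`U ≡ 1`): `E_N[Q²] = |Λ| Σ_v E_N[q_0 q_v]` at every step. -/
theorem integral_sq_rk3CloverCharge_hmcColdStart (N : ℕ) (ε' : ℝ) (m : ℕ) :
    ∫ U, (∑ x : Site 4 L, cloverPseudoscalar (fundamentalRep (Fin n)) x ((wilsonFlowRK3 ε')^[m] U)) ^ 2
        ∂((Measure.dirac (1 : GaugeConfig 4 L (Matrix.specialUnitaryGroup (Fin n) ℂ))).bind (nHit (hmcKernel B β ε w) N)) =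
      (Fintype.card (Site 4 L) : ℝ) * ∑ v : Site 4 L,
        ∫ U, cloverPseudoscalar (fundamentalRep (Fin n)) 0 ((wilsonFlowRK3 ε')^[m] U) *
          cloverPseudoscalar (fundamentalRep (Fin n)) v ((wilsonFlowRK3 ε')^[m] U)
          ∂((Measure.dirac (1 : GaugeConfig 4 L (Matrix.specialUnitaryGroup (Fin n) ℂ))).bind (nHit (hmcKernel B β ε w) N)) := by
  haveI := isMarkovKernel_nHit (hmcKernel B β ε w (d := 4) (L := L)) N
  exact integral_sq_rk3CloverCharge_hmcChain B β ε w dirac_one_map_torusConfigShift N ε' m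
    fun x y => integrable_of_continuous_sunConfig (continuous_rk3CloverDensity_mul ε' m x y)

/-- Hot start (`∏ dHaar`): `E_N[Q²] = |Λ| Σ_v E_N[q_0 q_v]` at every step. -/
theorem integral_sq_rk3CloverCharge_hmcHotStart (N : ℕ) (ε' : ℝ) (m : ℕ) :
    ∫ U, (∑ x : Site 4 L, cloverPseudoscalar (fundamentalRep (Fin n)) x ((wilsonFlowRK3 ε')^[m] U)) ^ 2
        ∂((Measure.pi fun _ : Edge 4 L => haarProbability (Matrix.specialUnitaryGroup (Fin n) ℂ)).bind
          (nHit (hmcKernel B β ε w) N)) =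
      (Fintype.card (Site 4 L) : ℝ) * ∑ v : Site 4 L,
        ∫ U, cloverPseudoscalar (fundamentalRep (Fin n)) 0 ((wilsonFlowRK3 ε')^[m] U) *
          cloverPseudoscalar (fundamentalRep (Fin n)) v ((wilsonFlowRK3 ε')^[m] U)
          ∂((Measure.pi fun _ : Edge 4 L => haarProbability (Matrix.specialUnitaryGroup (Fin n) ℂ)).bind
            (nHit (hmcKernel B β ε w) N)) := by
  haveI := isMarkovKernel_nHit (hmcKernel B β ε w (d := 4) (L := L)) N
  exact integral_sq_rk3CloverCharge_hmcChain B β ε w piHaar_map_torusConfigShift N ε' m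
    fun x y => integrable_of_continuous_sunConfig (continuous_rk3CloverDensity_mul ε' m x y)

/-- **In equilibrium: `⟨Q²⟩_{Λ,β} = |Λ| Σ_v ⟨q_0 q_v⟩_{Λ,β}`** under the Wilson measure of `SU(n)` (every `β`, every flow
discretisation `(ε', m)`) — no hypothesis. -/
theorem integral_sq_rk3CloverCharge_wilsonMeasure (β' : ℝ) (ε' : ℝ) (m : ℕ) :
    ∫ U, (∑ x : Site 4 L, cloverPseudoscalar (fundamentalRep (Fin n)) x ((wilsonFlowRK3 ε')^[m] U)) ^ 2
        ∂(wilsonMeasure (fundamentalRep (Fin n)) β') =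
      (Fintype.card (Site 4 L) : ℝ) * ∑ v : Site 4 L,
        ∫ U, cloverPseudoscalar (fundamentalRep (Fin n)) 0 ((wilsonFlowRK3 ε')^[m] U) *
          cloverPseudoscalar (fundamentalRep (Fin n)) v ((wilsonFlowRK3 ε')^[m] U) ∂(wilsonMeasure (fundamentalRep (Fin n)) β') := by
  haveI := isProbabilityMeasure_wilsonMeasure (d := 4) (L := L) (fundamentalRep (Fin n)) (continuous_fundamentalRep (Fin n)) β'
  exact integral_sq_sum_siteField (fun v => wilsonMeasure_map_torusConfigShift (fundamentalRep (Fin n)) β' v)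
    (fun x U => cloverPseudoscalar (fundamentalRep (Fin n)) x ((wilsonFlowRK3 ε')^[m] U))
    (fun v x U => rk3CloverDensity_torusConfigShift ε' m v x U)
    fun x y => integrable_of_continuous_sunConfig (continuous_rk3CloverDensity_mul ε' m x y)

/-- **`E_N[(Σ_x E_x)²] = |Λ| · Σ_v E_N[E_0 E_v]` AT EVERY HMC STEP** from any translation-invariant probability start, for the
measured energy density `E_x ∘ RK3_{ε'}^m` (the `t²E` observable up to the factor `t²/|Λ|`). -/
theorem integral_sq_rk3CloverEnergy_hmcChain {μ₀ : Measure (GaugeConfig 4 L (Matrix.specialUnitaryGroup (Fin n) ℂ))}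
    [IsProbabilityMeasure μ₀] (hT : ∀ v : Site 4 L, μ₀.map (TorusTranslation.torusConfigShift v) = μ₀) (N : ℕ) (ε' : ℝ)
    (m : ℕ) :
    ∫ U, (∑ x : Site 4 L, flowedCloverEnergy (fundamentalRep (Fin n)) 0 x ((wilsonFlowRK3 ε')^[m] U)) ^ 2
        ∂(μ₀.bind (nHit (hmcKernel B β ε w) N)) =
      (Fintype.card (Site 4 L) : ℝ) * ∑ v : Site 4 L,
        ∫ U, flowedCloverEnergy (fundamentalRep (Fin n)) 0 0 ((wilsonFlowRK3 ε')^[m] U) *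
          flowedCloverEnergy (fundamentalRep (Fin n)) 0 v ((wilsonFlowRK3 ε')^[m] U) ∂(μ₀.bind (nHit (hmcKernel B β ε w) N)) := by
  haveI := isMarkovKernel_nHit (hmcKernel B β ε w (d := 4) (L := L)) N
  exact integral_sq_sum_siteField (hmcChain_law_map_torusConfigShift B β ε w · (hT _) N)
    (fun x U => flowedCloverEnergy (fundamentalRep (Fin n)) 0 x ((wilsonFlowRK3 ε')^[m] U))
    (fun v x U => rk3CloverEnergy_torusConfigShift ε' m v x U)
    fun x y => integrable_of_continuous_sunConfig ((continuous_rk3CloverEnergy ε' m x).mul (continuous_rk3CloverEnergy ε' m y))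

/-- **THE VARIANCE OF THE LATTICE-AVERAGED ENERGY AT EVERY HMC STEP is the volume-averaged connected two-point function**:
`E_N[Ā²] − E_N[Ā]² = |Λ|⁻¹ Σ_v (E_N[E_0 E_v] − E_N[E_0] E_N[E_v])`, `Ā = |Λ|⁻¹ Σ_x E_x ∘ RK3^m`, from any translation-invariant
probability start. -/
theorem variance_rk3CloverEnergyAverage_hmcChain {μ₀ : Measure (GaugeConfig 4 L (Matrix.specialUnitaryGroup (Fin n) ℂ))}
    [IsProbabilityMeasure μ₀] (hT : ∀ v : Site 4 L, μ₀.map (TorusTranslation.torusConfigShift v) = μ₀) (N : ℕ) (ε' : ℝ)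
    (m : ℕ) :
    ∫ U, ((Fintype.card (Site 4 L) : ℝ)⁻¹ *
          ∑ x : Site 4 L, flowedCloverEnergy (fundamentalRep (Fin n)) 0 x ((wilsonFlowRK3 ε')^[m] U)) ^ 2
        ∂(μ₀.bind (nHit (hmcKernel B β ε w) N)) -
      (∫ U, (Fintype.card (Site 4 L) : ℝ)⁻¹ *
          ∑ x : Site 4 L, flowedCloverEnergy (fundamentalRep (Fin n)) 0 x ((wilsonFlowRK3 ε')^[m] U)
        ∂(μ₀.bind (nHit (hmcKernel B β ε w) N))) ^ 2 =
      (Fintype.card (Site 4 L) : ℝ)⁻¹ * ∑ v : Site 4 L,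
        (∫ U, flowedCloverEnergy (fundamentalRep (Fin n)) 0 0 ((wilsonFlowRK3 ε')^[m] U) *
            flowedCloverEnergy (fundamentalRep (Fin n)) 0 v ((wilsonFlowRK3 ε')^[m] U) ∂(μ₀.bind (nHit (hmcKernel B β ε w) N)) -
          (∫ U, flowedCloverEnergy (fundamentalRep (Fin n)) 0 0 ((wilsonFlowRK3 ε')^[m] U) ∂(μ₀.bind (nHit (hmcKernel B β ε w) N))) *
            ∫ U, flowedCloverEnergy (fundamentalRep (Fin n)) 0 v ((wilsonFlowRK3 ε')^[m] U)
              ∂(μ₀.bind (nHit (hmcKernel B β ε w) N))) := by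
  haveI := isMarkovKernel_nHit (hmcKernel B β ε w (d := 4) (L := L)) N
  exact variance_average_siteField (hmcChain_law_map_torusConfigShift B β ε w · (hT _) N)
    (fun x U => flowedCloverEnergy (fundamentalRep (Fin n)) 0 x ((wilsonFlowRK3 ε')^[m] U))
    (fun v x U => rk3CloverEnergy_torusConfigShift ε' m v x U)
    (fun x => integrable_of_continuous_sunConfig (continuous_rk3CloverEnergy ε' m x))
    fun x y => integrable_of_continuous_sunConfig ((continuous_rk3CloverEnergy ε' m x).mul (continuous_rk3CloverEnergy ε' m y))

/-- Cold start: `E_N[(ΣE)²] = |Λ| Σ_v E_N[E_0 E_v]` at every step. -/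
theorem integral_sq_rk3CloverEnergy_hmcColdStart (N : ℕ) (ε' : ℝ) (m : ℕ) :
    ∫ U, (∑ x : Site 4 L, flowedCloverEnergy (fundamentalRep (Fin n)) 0 x ((wilsonFlowRK3 ε')^[m] U)) ^ 2
        ∂((Measure.dirac (1 : GaugeConfig 4 L (Matrix.specialUnitaryGroup (Fin n) ℂ))).bind (nHit (hmcKernel B β ε w) N)) =
      (Fintype.card (Site 4 L) : ℝ) * ∑ v : Site 4 L,
        ∫ U, flowedCloverEnergy (fundamentalRep (Fin n)) 0 0 ((wilsonFlowRK3 ε')^[m] U) *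
          flowedCloverEnergy (fundamentalRep (Fin n)) 0 v ((wilsonFlowRK3 ε')^[m] U)
          ∂((Measure.dirac (1 : GaugeConfig 4 L (Matrix.specialUnitaryGroup (Fin n) ℂ))).bind (nHit (hmcKernel B β ε w) N)) :=
  integral_sq_rk3CloverEnergy_hmcChain B β ε w dirac_one_map_torusConfigShift N ε' m

/-- Cold start: the variance of the lattice-averaged energy at step `N` is the volume-averaged connected two-point function. -/
theorem variance_rk3CloverEnergyAverage_hmcColdStart (N : ℕ) (ε' : ℝ) (m : ℕ) :
    ∫ U, ((Fintype.card (Site 4 L) : ℝ)⁻¹ *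
          ∑ x : Site 4 L, flowedCloverEnergy (fundamentalRep (Fin n)) 0 x ((wilsonFlowRK3 ε')^[m] U)) ^ 2
        ∂((Measure.dirac (1 : GaugeConfig 4 L (Matrix.specialUnitaryGroup (Fin n) ℂ))).bind (nHit (hmcKernel B β ε w) N)) -
      (∫ U, (Fintype.card (Site 4 L) : ℝ)⁻¹ *
          ∑ x : Site 4 L, flowedCloverEnergy (fundamentalRep (Fin n)) 0 x ((wilsonFlowRK3 ε')^[m] U)
        ∂((Measure.dirac (1 : GaugeConfig 4 L (Matrix.specialUnitaryGroup (Fin n) ℂ))).bind (nHit (hmcKernel B β ε w) N))) ^ 2 =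
      (Fintype.card (Site 4 L) : ℝ)⁻¹ * ∑ v : Site 4 L,
        (∫ U, flowedCloverEnergy (fundamentalRep (Fin n)) 0 0 ((wilsonFlowRK3 ε')^[m] U) *
            flowedCloverEnergy (fundamentalRep (Fin n)) 0 v ((wilsonFlowRK3 ε')^[m] U)
            ∂((Measure.dirac (1 : GaugeConfig 4 L (Matrix.specialUnitaryGroup (Fin n) ℂ))).bind (nHit (hmcKernel B β ε w) N)) -
          (∫ U, flowedCloverEnergy (fundamentalRep (Fin n)) 0 0 ((wilsonFlowRK3 ε')^[m] U)
              ∂((Measure.dirac (1 : GaugeConfig 4 L (Matrix.specialUnitaryGroup (Fin n) ℂ))).bind (nHit (hmcKernel B β ε w) N))) *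
            ∫ U, flowedCloverEnergy (fundamentalRep (Fin n)) 0 v ((wilsonFlowRK3 ε')^[m] U)
              ∂((Measure.dirac (1 : GaugeConfig 4 L (Matrix.specialUnitaryGroup (Fin n) ℂ))).bind (nHit (hmcKernel B β ε w) N))) :=
  variance_rk3CloverEnergyAverage_hmcChain B β ε w dirac_one_map_torusConfigShift N ε' m

/-- Hot start: `E_N[(ΣE)²] = |Λ| Σ_v E_N[E_0 E_v]` at every step. -/
theorem integral_sq_rk3CloverEnergy_hmcHotStart (N : ℕ) (ε' : ℝ) (m : ℕ) :
    ∫ U, (∑ x : Site 4 L, flowedCloverEnergy (fundamentalRep (Fin n)) 0 x ((wilsonFlowRK3 ε')^[m] U)) ^ 2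
        ∂((Measure.pi fun _ : Edge 4 L => haarProbability (Matrix.specialUnitaryGroup (Fin n) ℂ)).bind
          (nHit (hmcKernel B β ε w) N)) =
      (Fintype.card (Site 4 L) : ℝ) * ∑ v : Site 4 L,
        ∫ U, flowedCloverEnergy (fundamentalRep (Fin n)) 0 0 ((wilsonFlowRK3 ε')^[m] U) *
          flowedCloverEnergy (fundamentalRep (Fin n)) 0 v ((wilsonFlowRK3 ε')^[m] U)
          ∂((Measure.pi fun _ : Edge 4 L => haarProbability (Matrix.specialUnitaryGroup (Fin n) ℂ)).bind
            (nHit (hmcKernel B β ε w) N)) :=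
  integral_sq_rk3CloverEnergy_hmcChain B β ε w piHaar_map_torusConfigShift N ε' m

/-- **In equilibrium: `⟨(ΣE)²⟩_{Λ,β} = |Λ| Σ_v ⟨E_0 E_v⟩_{Λ,β}`** (Wilson measure of `SU(n)`, every `β`, every `(ε', m)`). -/
theorem integral_sq_rk3CloverEnergy_wilsonMeasure (β' : ℝ) (ε' : ℝ) (m : ℕ) :
    ∫ U, (∑ x : Site 4 L, flowedCloverEnergy (fundamentalRep (Fin n)) 0 x ((wilsonFlowRK3 ε')^[m] U)) ^ 2
        ∂(wilsonMeasure (fundamentalRep (Fin n)) β') =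
      (Fintype.card (Site 4 L) : ℝ) * ∑ v : Site 4 L,
        ∫ U, flowedCloverEnergy (fundamentalRep (Fin n)) 0 0 ((wilsonFlowRK3 ε')^[m] U) *
          flowedCloverEnergy (fundamentalRep (Fin n)) 0 v ((wilsonFlowRK3 ε')^[m] U) ∂(wilsonMeasure (fundamentalRep (Fin n)) β') := by
  haveI := isProbabilityMeasure_wilsonMeasure (d := 4) (L := L) (fundamentalRep (Fin n)) (continuous_fundamentalRep (Fin n)) β'
  exact integral_sq_sum_siteField (fun v => wilsonMeasure_map_torusConfigShift (fundamentalRep (Fin n)) β' v)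
    (fun x U => flowedCloverEnergy (fundamentalRep (Fin n)) 0 x ((wilsonFlowRK3 ε')^[m] U))
    (fun v x U => rk3CloverEnergy_torusConfigShift ε' m v x U)
    fun x y => integrable_of_continuous_sunConfig ((continuous_rk3CloverEnergy ε' m x).mul (continuous_rk3CloverEnergy ε' m y))

end ArmE2

end Summit.Ventures.LatticeQCDFlow.Scoring
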